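import Literature.MathematicalPhysics.QuantumFieldTheory.BalabanImbrieJaffe1984to88.BIJ88Eq564Torus

/-!
# `BalabanImbrieJaffe1984to88.BIJ88Eq542Torus` — T. Bałaban, J. Imbrie, A. Jaffe, *Effective action and cluster properties of the abelian
Higgs model*, Commun. Math. Phys. **114** (1988) 257–315 [BalabanImbrieJaffe1988], Sect. 5.4 *Gauge Transformation*, pp. 281–282 [PDF 25–26]:
**(5.4.2)** (the background field of a term localized in `□₀`) with the located sentence *"The values of A′ outside □ do not matter because
𝒟_{k,loc} has a range (1/2L)r(e_{k−1}), and so u_{k,b} doesn't depend on them for b ∈ □₀"*, and **(5.4.3)–(5.4.6)** (the nonlocal gauge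
transformation (5.4.1) and the background gauge transformation (5.4.5)) — ON THE TORUS CARRIER OF RECORD (kind «model instance»).

statement-level skeleton of published theorems with citation tags; proofs where landed; nothing here is a claim about the Yang–Mills mass gap

PDF held: `paper:balaban1988-cmp114-bij-abelian-higgs-effective-action` (journal page = PDF page + 256); p. 281 [PDF 25] rendered and read as
an image this session (CCITT-G4 ×2, seat folder `renders/original-p025-x2.png`), p. 282 [PDF 26] = `HOME/lit-balaban-r16/renders/cmp114/
original-p026-x2.png`; p. 280 ((5.3.3)–(5.3.4)) and p. 274 ((4.2)) as read for gen 6's `BIJ88Eq533Torus`.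

CITATION HEADER (lean-in-tree rule).  Part of the lit-balaban TYPED SKELETON (HOME `run/shared/lean/pub/lit-balaban/`), PHASE-2 proof
seat p31 gen 7 (unit `lit-balaban-p31-g7`; TAKING line HOME/STATUS.md 2026-08-21T11:48Z).  WHAT IS REPRODUCED: row `C2.Eq5.4.1-5.4.6` of
`HOME/lit-balaban-r16/ROWS-C2-part2.md` (owner r16) — members (5.4.2) (recorded there as *"= `bgExp` instance"*, reader level), (5.4.3)/(5.4.4)
(r16's ring identities `BIJ88Sect5StatementsPart3.eq543/eq544`, here read on functions for the concrete `Q^{s*}_k`) and (5.4.5) → (5.4.6)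
(r16's mechanism `bgGaugeU_bgExp` + `grad_add_decomp`), at the torus level of gen 6's (5.3.3)/(5.3.4) (`BIJ88Eq533Torus`, p259957).

THE PRINTED TEXT (verbatim, p. 281–282).  *"Let us fix a set of sites where fields ψ or φ sit; then the dependence on u_{k,b} is only for b
in some cube □₀ enclosing all points closer than (1/2L)r(e_{k−1}) to the fixed sites. … The gauge field appearing in any one term can be
written as u_k = (Q^{s*}_{k+1}v) exp ie_kη[(Q^{s*}_k − 𝒟_{k,loc}∂*Q^{e*}_k∂)□A′ − L^{−2}𝒟_{k,loc}∂*Q^{e*}_{k+1}f]_b, (5.4.2) where □ is a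
½r(e_k)-cube in T₁^{(k)*} containing a collar neighborhood around □₀. … The values of A′ outside □ do not matter because 𝒟_{k,loc} has a
range (1/2L)r(e_{k−1}), and so u_{k,b} doesn't depend on them for b ∈ □₀. We now write (Q^{s*}_k − 𝒟_{k,loc}∂*Q^{e*}_k∂)□A′ = (Q^{s*}_k −
𝒟_k∂*Q^{e*}_k∂)□A′ + w′₁A′. (5.4.3) … The nonlocal gauge transformation (5.4.1) is now applied and we have (Q^{s*}_k − 𝒟_{k,loc}∂*Q^{e*}_k∂)□A′
= (H_k + ∂C_k)□A′ + w′₁A′ = H_{k,loc}A′ + ∂C_k□A′ + w₁A′. (5.4.4) We have put w₁ = w′₁ + H_k□ − H_{k,loc} … The background gauge transformation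
u_{k,b} → u′_{k,b} = u_{k,b} exp(−ie_kη(∂Λ̄₃^{(k)}C_k□A′)(b)), … (5.4.5) is now performed on the term localized in □₀. The background field
becomes u′_k = (Q^{s*}_{k+1}v) exp ie_kη[H_{k,loc}A′ + ∂Λ̄₃^{(k)c}C_k□A′ + w₁A′ − L^{−2}𝒟_{k,loc}∂*Q^{e*}_{k+1}f], (5.4.6)"*.

WHAT (5.4.2) IS, and what is data.  (5.4.2) is (5.3.4) — gen 6's `eq533_inside`: inside `Λ̄₁^{(k)*}`, `u_k(b) = (Q^{s*}_{k+1}v)(b) exp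
ie_kη[(Q^{s*}_kA′)(b) − g(b)]`, `g = 𝒟_{k,loc}∂*Q^{e*}_kf^{(k)}` — with `A′` replaced by its cut-off `□A′` inside the two operators; the
replacement is legitimate on the bonds of `□₀` by TWO locality facts: `Q^{s*}_k` only copies the value at the k-block bond (`Qsstar_indicator`,
this file) and `T∂ := 𝒟_{k,loc}∂*Q^{e*}_k∂` has finite range (the printed sentence).  The analytic operators are DATA exactly as in the typed
(5.3.4) (`BIJ88Sect5StatementsPart3.bg534`): `T = 𝒟_{k,loc}∂*Q^{e*}_k` (here `T_loc`), `T_k = 𝒟_k∂*Q^{e*}_k`, `H_k`, `H_{k,loc}` linear maps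
from unit-lattice plaquette / bond functions to η-lattice bond functions, `C_k` to η-lattice site functions (`∂C_k` = the η-gradient
`grad η⁻¹` of (4.16)), `Q^{e*} = Qes` (so `T(Q^{e*}f)` is the printed `𝒟_{k,loc}∂*Q^{e*}_{k+1}f` by `Q^{e*}_kQ^{e*} = Q^{e*}_{k+1}`, gen 2's
`BIJ85Eq224ProofPart2.QestarIter_succ`); the unit-lattice `∂` is CONCRETE (`LatticeFieldCalculus.curl 1`) and `Q^{s*}_k` is CONCRETE (the
real pull-back `(BIJ85Eq224Proof.torusBlockBondsIter P i k).Qsstar`).  (5.4.1) = (2.20) enters as the displayed hypothesis `h541` on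
functions (r18's `BIJ88Sect2Statements.Eq220` is its ring form), the (5.3.4) locality as `hT` (as in gen 6's `eq534_of_eq533`), and the
range sentence as the dependence hypothesis `hdep` — EACH range hypothesis having a MECHANISM THEOREM in §2/§2b that derives it from a range
relation and the collar geometry (the metric form, torus `ℓ^∞` distance `LatticeFieldCalculus.supDist`, is `BIJ88Eq5410Torus.starP_of_collar`).
The cubes: `□ = X_□*` (bond star of a unit-lattice site set), `□A′ = X_□*·A′`
(`Set.indicator`), `□₀` read on `T_η` as the bonds whose k-block endpoints lie in `X₀ ⊆ X_□` (p. 281: `□₀` is a cube of η-bonds of size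
¼r(e_k)), `Λ̄₃^{(k)}` = a site set of `T_η` (its cut-off the indicator), `Λ̄₁^{(k)} = blockUnion (k+1) X` as in gen 6.

CARRIERS (all of record): η-lattice = torus level `i`, unit lattice `T₁^{(k)}` = level `i + k`, block lattice = level `i + k + 1` (standing
range `i + k + 1 ≤ m + K`); U(1) fields read in `ℂ` by `toC`; r18's `backgroundU` ((4.2)) / `bgGaugeU` ((4.16) = (5.4.5)); r16's `bgExp`;
gen 6's `cutoffG`, `blockUnion`, `liftBonds`; `starB`/`starP` (p. 266).

WHAT IS PROVED (theorems only; 0 `sorry`, standard axioms, no `def`, no `Prop`-valued fact introduced).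
* §1 the real pull-back bond by bond: `Qsstar_apply`, **`Qsstar_indicator`** (`Q^{s*}_k(□A′) = [k-block bond ∈ □]·Q^{s*}_kA′`),
  `Qsstar_indicator_of_mem_liftBonds`, `Qsstar_indicator_compl_add` (`Q^{s*}_kA′ = Q^{s*}_k(□ᶜA′) + Q^{s*}_k(□A′)`).
* §2 RANGE ⟹ INDEPENDENCE (the printed sentence as a mechanism): `bonds_mem_starB_of_mem_starP`, **`curl_indicator_of_mem_starP`** (`∂(□A′) = ∂A′`
  on `□**`), **`apply_curl_indicator_eq_of_range`** (`(T∂(□A′))(b) = (T∂A′)(b)` when `T` at `b` sees only plaquettes of `□**`), `apply_indicator_eq_of_range`,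
  `range_comp` (ranges compose), `curl_range`, `Qsstar_range`.
* (the collar in the torus `ℓ^∞` distance `supDist` — *"□ is a ½r(e_k)-cube … containing a collar neighborhood around □₀"* — and the discharge of
  the `hdep` hypothesis of `eq542_torus` for a `T` of `ℓ^∞` range `R` are in the companion `BIJ88Eq5410Torus`, §0.)
* §3 `blockUnion_mono`, **`eq542_torus`** ((5.4.2): on `b ∈ □₀ ∩ Λ̄₁^{(k)*}`, `u_k(b) = (Q^{s*}_{k+1}v)(b) · exp ie_kη[(Q^{s*}_k(□A′))(b) −
  (T∂(□A′))(b) − L^{−2}(T(Q^{e*}f))(b)]`).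
* §4 **`eq544_torus`** ((5.4.3)–(5.4.4) on functions from `h541`, with `w′₁A′ = (T_k − T_loc)∂(□A′)` and `w₁A′ = w′₁A′ + H_k(□A′) − H_{k,loc}A′`
  spelled out), `grad_indicator_add_compl` (`∂C_k□A′ = ∂Λ̄₃C_k□A′ + ∂Λ̄₃ᶜC_k□A′`), **`eq546_torus`** ((5.4.5) → (5.4.6): the `bgGaugeU` transform with
  `λ = Λ̄₃·C_k(□A′)` of `u_k` is `(Q^{s*}_{k+1}v) exp ie_kη[H_{k,loc}A′ + ∂(Λ̄₃ᶜ·C_k□A′) + w₁A′ − L^{−2}T(Q^{e*}f)]` on `□₀ ∩ Λ̄₁*`).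
HONEST SCOPE.  Not here: the bounds on `w′₁`, `w₁` (p. 282; p08's `BIJ88Ineq547W1Prime`), (5.4.7) (p36's `BIJ88Ineq547Proof`), the specific
radii ¼r(e_k), ½r(e_k), (1/2L)r(e_{k−1}) (the collar enters with abstract radii `N₀ + R + 2 ≤ N`), the identity (5.4.1) for the concrete
kernels (hypothesis `h541`; (2.20) is PROVED on the tori for the operators of record by p08 gen 7's `BIJ88Eq220Torus.eq220_torus` — level
`i = 0`, Euclidean carriers `QsE`/`DkE`/`QesOp`/`HkE`/`CkE`; the transfer of `h541` to those carriers is not made here, and `T_loc`, `H_{k,loc}`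
have no torus construction anywhere — they are data),
the φ, ψ rotations of (5.4.5) (scalar side, p. 282).  (5.4.8)–(5.4.10) are the companion file `BIJ88Eq5410Torus`.  Import: gen 6's
`BIJ88Eq564Torus` (p260762/p261107; it imports `BIJ88Eq533Torus` p259957 — `starB_mono` is used from there).
Unit `lit-balaban-p31` (literature-prover-lit-balaban-p31-g7-0), 2026-08-21.
-/

namespace Literature.MathematicalPhysics.QuantumFieldTheory.BalabanImbrieJaffe1984to88.BIJ88Eq542Torus

open Literature.MathematicalPhysics.QuantumFieldTheory.Balaban1983to89
open BIJ88Sect3Statements (U1 toC toC_mul toC_one starB mem_starB)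
open BIJ88Sect4Statements (backgroundU bgGaugeU)
open BIJ88Sect5StatementsPart3 (bgExp bracket534 bg534 bgGaugeU_bgExp)
open BIJ85BlockAveragesTorus (expU1 toC_expU1 surfMul)
open BIJ85Eq453GaugeField (qsstarGIter qsstarGIter_of_interior qsstarGIter_of_mem)
open BIJ85Eq224Proof (torusBlockBondsIter mem_BsIter_iff blockOfIter_shift iter_L)
open BIJ88Eq536Linearization (cutoff)
open BIJ88Eq533Torus (cutoffG cutoffG_of_mem cutoffG_of_not_mem blockUnion mem_blockUnion liftBonds mem_liftBonds liftBonds_starB_iff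
  eq533_inside eq534_of_eq533 Qsstar_indicator_of_mem_starB)
open BIJ88Eq564Torus (starB_mono)
open B7SectAStatements (blockOfIter)
open LatticeFieldCalculus (grad curl)
open scoped BigOperators Real
open Complex Finset

noncomputable section

variable {P : Params} {i : ℕ}

/-! ## §0 Torus bookkeeping -/

/-- kernel: `y + e_μ ≠ y` on every torus of the series. [folklore] -/
private theorem shift_ne_self {n : ℕ} (y : Balaban1983to89.Site P n) (μ : Fin P.d) : y.shift μ ≠ y := by
  intro h
  have h1 := congrFun h μ
  simp only [Balaban1983to89.Site.shift, Function.update_self] at h1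
  exact one_ne_zero (add_eq_left.1 h1)

/-- kernel: a bond strictly inside a k-block lies in no k-corridor `B^s_k(c)`. [cite: BalabanImbrieJaffe1985, (4.5.3) p.312] -/
private theorem not_mem_BsIter_of_interior {k : ℕ} {b : PBond P i} (hb : blockOfIter k b.tgt = blockOfIter k b.src)
    (c : PBond P (i + k)) : b ∉ (torusBlockBondsIter P i k).Bs c := by
  rw [mem_BsIter_iff]
  rintro ⟨h1, h2⟩
  exact shift_ne_self c.src c.dir (h2.symm.trans (hb.trans h1))

/-- kernel: a bond not strictly inside a k-block lies in the k-corridor of its k-fold block bond (standing range).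
[cite: BalabanImbrieJaffe1985, (4.5.3) p.312] -/
private theorem mem_BsIter_of_not_interior {k : ℕ} (hk : i + k ≤ P.m + P.K) {b : PBond P i}
    (hb : blockOfIter k b.tgt ≠ blockOfIter k b.src) :
    b ∈ (torusBlockBondsIter P i k).Bs (⟨blockOfIter k b.src, b.dir⟩ : PBond P (i + k)) := by
  rw [mem_BsIter_iff]
  exact ⟨rfl, (blockOfIter_shift k hk b.src b.dir).resolve_left hb⟩

/-! ## §1 The real pull-back `Q^{s*}_k` bond by bond; cut-offs `□A′` through `Q^{s*}_k` -/

/-- kernel: **the pull-back (2.17) at block size `L^k`, bond by bond**: `(Q^{s*}_kA)(b) = 0` strictly inside a k-block, and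
`= L^k·A(⟨B^k(b₋), μ⟩)` on the corridor of the k-block bond of `b` (standing range). [cite: BalabanImbrieJaffe1985, (2.17) p.304] -/
theorem Qsstar_apply {k : ℕ} (hk : i + k ≤ P.m + P.K) (A : PBond P (i + k) → ℝ) (b : PBond P i) :
    (torusBlockBondsIter P i k).Qsstar A b =
      if blockOfIter k b.tgt = blockOfIter k b.src then 0
      else ((P.L : ℝ) ^ k) * A ⟨blockOfIter k b.src, b.dir⟩ := by
  split_ifs with hb
  · exact (torusBlockBondsIter P i k).Qsstar_of_not_mem _ (not_mem_BsIter_of_interior hb)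
  · rw [(torusBlockBondsIter P i k).Qsstar_of_mem _ (mem_BsIter_of_not_interior hk hb), iter_L, Nat.cast_pow]

/-- **A cut-off `□A′` (the indicator of a unit-lattice bond set `□`) passes through the real pull-back**: `(Q^{s*}_k(□A′))(b) = (Q^{s*}_kA′)(b)`
if the k-block bond of `b` lies in `□`, and `= 0` if it does not (inside k-blocks both vanish; standing range) — the real-operator
companion of gen 6's `qsstarGIter_cutoffG`. [cite: BalabanImbrieJaffe1988, (5.4.2) p.281] -/
theorem Qsstar_indicator {k : ℕ} (hk : i + k ≤ P.m + P.K) (Bx : Finset (PBond P (i + k))) (A' : PBond P (i + k) → ℝ) (b : PBond P i) :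
    (torusBlockBondsIter P i k).Qsstar ((↑Bx : Set (PBond P (i + k))).indicator A') b =
      if (⟨blockOfIter k b.src, b.dir⟩ : PBond P (i + k)) ∈ Bx then (torusBlockBondsIter P i k).Qsstar A' b else 0 := by
  rw [Qsstar_apply hk, Qsstar_apply hk]
  by_cases hb : blockOfIter k b.tgt = blockOfIter k b.src
  · simp [hb]
  · simp only [hb, if_false]
    by_cases hc : (⟨blockOfIter k b.src, b.dir⟩ : PBond P (i + k)) ∈ Bx
    · rw [if_pos hc, Set.indicator_of_mem (Finset.mem_coe.2 hc)]
    · rw [if_neg hc, Set.indicator_of_notMem (fun h => hc (Finset.mem_coe.1 h)), mul_zero]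

/-- kernel: **on the bonds whose k-block bond lies in `□` the cut-off is invisible**, `(Q^{s*}_k(□A′))(b) = (Q^{s*}_kA′)(b)` for
`b ∈ liftBonds k □` — the `Q^{s*}_k` half of *"u_{k,b} doesn't depend on [the values of A′ outside □] for b ∈ □₀"* (standing range).
[cite: BalabanImbrieJaffe1988, (5.4.2) p.281] -/
theorem Qsstar_indicator_of_mem_liftBonds {k : ℕ} (hk : i + k ≤ P.m + P.K) {Bx : Finset (PBond P (i + k))} (A' : PBond P (i + k) → ℝ)
    {b : PBond P i} (hb : b ∈ liftBonds k Bx) :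
    (torusBlockBondsIter P i k).Qsstar ((↑Bx : Set (PBond P (i + k))).indicator A') b = (torusBlockBondsIter P i k).Qsstar A' b := by
  rw [Qsstar_indicator hk, if_pos (mem_liftBonds.1 hb)]

/-- kernel: the splitting `A′ = □ᶜA′ + □A′` through the pull-back, `Q^{s*}_kA′ = Q^{s*}_k(□ᶜA′) + Q^{s*}_k(□A′)` (standing range).
[cite: BalabanImbrieJaffe1988, (5.4.9) p.283] -/
theorem Qsstar_indicator_compl_add {k : ℕ} (hk : i + k ≤ P.m + P.K) (Bx : Finset (PBond P (i + k))) (A' : PBond P (i + k) → ℝ)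
    (b : PBond P i) :
    (torusBlockBondsIter P i k).Qsstar ((↑Bxᶜ : Set (PBond P (i + k))).indicator A') b +
      (torusBlockBondsIter P i k).Qsstar ((↑Bx : Set (PBond P (i + k))).indicator A') b = (torusBlockBondsIter P i k).Qsstar A' b := by
  rw [Qsstar_indicator hk, Qsstar_indicator hk]
  by_cases hc : (⟨blockOfIter k b.src, b.dir⟩ : PBond P (i + k)) ∈ Bx
  · rw [if_neg (fun h => (Finset.mem_compl.1 h) hc), if_pos hc, zero_add]
  · rw [if_pos (Finset.mem_compl.2 hc), if_neg hc, add_zero]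

/-! ## §2 *"𝒟_{k,loc} has a range (1/2L)r(e_{k−1}), and so u_{k,b} doesn't depend on them for b ∈ □₀"* — the mechanism -/

/-- kernel: lattice steps commute, `x + e_μ + e_ν = x + e_ν + e_μ`. [folklore] -/
private theorem shift_comm {n : ℕ} (x : Balaban1983to89.Site P n) (μ ν : Fin P.d) : (x.shift μ).shift ν = (x.shift ν).shift μ := by
  funext κ
  simp only [Balaban1983to89.Site.shift, Function.update_apply]
  split_ifs <;> subst_vars <;> simp_all

/-- kernel: the four bonds of a plaquette of `X**` lie in `X*` (p. 266: `X*`/`X**` = bonds/plaquettes with all endpoints in `X`).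
[cite: BalabanImbrieJaffe1988, (3.5) p.266] -/
theorem bonds_mem_starB_of_mem_starP {n : ℕ} (X : Finset (Balaban1983to89.Site P n)) {p : Balaban1983to89.Plaq P n}
    (hp : p ∈ BIJ88Sect3Statements.starP X) :
    (⟨p.src, p.μ⟩ : PBond P n) ∈ starB X ∧ (⟨p.src.shift p.μ, p.ν⟩ : PBond P n) ∈ starB X ∧
      (⟨p.src.shift p.ν, p.μ⟩ : PBond P n) ∈ starB X ∧ (⟨p.src, p.ν⟩ : PBond P n) ∈ starB X := by
  simp only [BIJ88Sect3Statements.starP, Finset.mem_filter, Finset.mem_univ, true_and] at hp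
  obtain ⟨hx, hxμ, hxν, hxμν⟩ := hp
  refine ⟨(mem_starB X _).2 ⟨hx, hxμ⟩, (mem_starB X _).2 ⟨hxμ, hxμν⟩, (mem_starB X _).2 ⟨hxν, ?_⟩, (mem_starB X _).2 ⟨hx, hxν⟩⟩
  show (p.src.shift p.ν).shift p.μ ∈ X
  rw [← shift_comm]
  exact hxμν

/-- **The unit-lattice curl is local**: on a plaquette of `□** = X**` the curl of the cut-off field `□A′ = X*·A′` is the curl of `A′`
(the four bonds of the plaquette lie in `□ = X*`; any constant `c`). [cite: BalabanImbrieJaffe1988, (5.4.2) p.281] -/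
theorem curl_indicator_of_mem_starP {n : ℕ} (c : ℝ) (X : Finset (Balaban1983to89.Site P n)) (A : PBond P n → ℝ)
    {p : Balaban1983to89.Plaq P n} (hp : p ∈ BIJ88Sect3Statements.starP X) :
    curl c ((↑(starB X) : Set (PBond P n)).indicator A) p = curl c A p := by
  obtain ⟨h1, h2, h3, h4⟩ := bonds_mem_starB_of_mem_starP X hp
  simp only [curl, Set.indicator_of_mem (Finset.mem_coe.2 h1), Set.indicator_of_mem (Finset.mem_coe.2 h2),
    Set.indicator_of_mem (Finset.mem_coe.2 h3), Set.indicator_of_mem (Finset.mem_coe.2 h4)]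

/-- **RANGE ⟹ INDEPENDENCE, the mechanism of p. 281–282.**  A map `T` from unit-lattice plaquette functions to η-lattice bond functions whose
value at the η-bond `b` depends only on the plaquettes `near b` (a RANGE statement, as *"𝒟_{k,loc} has a range (1/2L)r(e_{k−1})"* for
`T = 𝒟_{k,loc}∂*Q^{e*}_k`: hypothesis `hT`), a unit-lattice site set `X` (the cube `□`) whose plaquette star contains every plaquette near `b`
(*"□ … containing a collar neighborhood around □₀"*, hypothesis `hX`): then `(T∂(□A′))(b) = (T∂A′)(b)` — *"The values of A′ outside □ do not
matter … u_{k,b} doesn't depend on them for b ∈ □₀"* (`∂` = the unit-lattice curl with any constant). [cite: BalabanImbrieJaffe1988, (5.4.2) p.281] -/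
theorem apply_curl_indicator_eq_of_range {n : ℕ} {β α : Type*} (T : (Balaban1983to89.Plaq P n → ℝ) → β → α)
    (near : β → Balaban1983to89.Plaq P n → Prop) {b : β}
    (hT : ∀ F₁ F₂ : Balaban1983to89.Plaq P n → ℝ, (∀ p, near b p → F₁ p = F₂ p) → T F₁ b = T F₂ b)
    (X : Finset (Balaban1983to89.Site P n)) (hX : ∀ p, near b p → p ∈ BIJ88Sect3Statements.starP X) (c : ℝ) (A : PBond P n → ℝ) :
    T (curl c ((↑(starB X) : Set (PBond P n)).indicator A)) b = T (curl c A) b :=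
  hT _ _ fun p hp => curl_indicator_of_mem_starP c X A (hX p hp)

/-- kernel: the same for a map on unit-lattice BOND functions (e.g. `Q^{s*}_k`, `H_k`, `C_k`): if `(S A)(b)` depends only on the bonds `near b`
and `□` contains them, `(S(□A))(b) = (SA)(b)`. [cite: BalabanImbrieJaffe1988, (5.4.2) p.281] -/
theorem apply_indicator_eq_of_range {n : ℕ} {β α : Type*} (S : (PBond P n → ℝ) → β → α) (near : β → PBond P n → Prop) {b : β}
    (hS : ∀ A₁ A₂ : PBond P n → ℝ, (∀ c, near b c → A₁ c = A₂ c) → S A₁ b = S A₂ b) (Bx : Finset (PBond P n))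
    (hBx : ∀ c, near b c → c ∈ Bx) (A : PBond P n → ℝ) :
    S ((↑Bx : Set (PBond P n)).indicator A) b = S A b :=
  hS _ _ fun c hc => Set.indicator_of_mem (Finset.mem_coe.2 (hBx c hc)) A

/-- kernel: **ranges compose** — if `(T F)(b)` depends only on the plaquettes `near₁ b`, and `(D A)(p)` only on the bonds `near₂ p`, then
`(T(DA))(b)` depends only on the bonds `c` with `near₁ b p ∧ near₂ p c` for some `p` (the shape in which the range of the composite
`𝒟_{k,loc}∂*Q^{e*}_k∂` is read off its factors). [cite: BalabanImbrieJaffe1988, (5.4.2) p.281] -/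
theorem range_comp {n : ℕ} {β α γ : Type*} (T : (γ → ℝ) → β → α) (D : (PBond P n → ℝ) → γ → ℝ)
    (near₁ : β → γ → Prop) (near₂ : γ → PBond P n → Prop)
    (hT : ∀ F₁ F₂ : γ → ℝ, ∀ b, (∀ p, near₁ b p → F₁ p = F₂ p) → T F₁ b = T F₂ b)
    (hD : ∀ A₁ A₂ : PBond P n → ℝ, ∀ p, (∀ c, near₂ p c → A₁ c = A₂ c) → D A₁ p = D A₂ p)
    (A₁ A₂ : PBond P n → ℝ) (b : β) (h : ∀ c, (∃ p, near₁ b p ∧ near₂ p c) → A₁ c = A₂ c) :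
    T (D A₁) b = T (D A₂) b :=
  hT _ _ b fun p hp => hD _ _ p fun c hc => h c ⟨p, hp, hc⟩

/-- kernel: the RANGE of the unit-lattice curl — `(∂A)(p)` depends only on the four bonds of `p`. [cite: BalabanImbrieJaffe1988, (3.5) p.266] -/
theorem curl_range {n : ℕ} (c : ℝ) (A₁ A₂ : PBond P n → ℝ) (p : Balaban1983to89.Plaq P n)
    (h : ∀ b : PBond P n, (b = ⟨p.src, p.μ⟩ ∨ b = ⟨p.src.shift p.μ, p.ν⟩ ∨ b = ⟨p.src.shift p.ν, p.μ⟩ ∨ b = ⟨p.src, p.ν⟩) → A₁ b = A₂ b) :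
    curl c A₁ p = curl c A₂ p := by
  simp only [curl, h _ (Or.inl rfl), h _ (Or.inr (Or.inl rfl)), h _ (Or.inr (Or.inr (Or.inl rfl))), h _ (Or.inr (Or.inr (Or.inr rfl)))]

/-- kernel: the RANGE of the real pull-back — `(Q^{s*}_kA)(b)` depends only on `A` at the k-block bond of `b` (standing range).
[cite: BalabanImbrieJaffe1985, (2.17) p.304] -/
theorem Qsstar_range {k : ℕ} (hk : i + k ≤ P.m + P.K) (A₁ A₂ : PBond P (i + k) → ℝ) (b : PBond P i)
    (h : A₁ ⟨blockOfIter k b.src, b.dir⟩ = A₂ ⟨blockOfIter k b.src, b.dir⟩) :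
    (torusBlockBondsIter P i k).Qsstar A₁ b = (torusBlockBondsIter P i k).Qsstar A₂ b := by
  rw [Qsstar_apply hk, Qsstar_apply hk, h]

/-! ## §3 (5.4.2) on the torus -/

/-- kernel: `X₀ ⊆ X ⟹ blockUnion k X₀ ⊆ blockUnion k X`. [cite: BalabanImbrieJaffe1988, (4.1) p.274] -/
theorem blockUnion_mono (k : ℕ) {X₀ X : Finset (Balaban1983to89.Site P (i + k))} (h : X₀ ⊆ X) :
    blockUnion (i := i) k X₀ ⊆ blockUnion k X := by
  intro x hx
  rw [mem_blockUnion] at hx ⊢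
  exact h hx

/-- **(5.4.2) ON THE TORUS.**  p. 281 [PDF 25], verbatim: *"The gauge field appearing in any one term can be written as u_k = (Q^{s*}_{k+1}v)
exp ie_kη[(Q^{s*}_k − 𝒟_{k,loc}∂*Q^{e*}_k∂)□A′ − L^{−2}𝒟_{k,loc}∂*Q^{e*}_{k+1}f]_b, (5.4.2) where □ is a ½r(e_k)-cube in T₁^{(k)*} containing a
collar neighborhood around □₀. … The values of A′ outside □ do not matter because 𝒟_{k,loc} has a range (1/2L)r(e_{k−1}), and so u_{k,b}
doesn't depend on them for b ∈ □₀."*  HERE: `u_k` = the background field (4.2) after the translation (5.3.1) (gen 6's `eq533_*`: data `u′ =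
e^{ie_kA′}` on `Λ₁^{(k)*}`, `v`, `g = 𝒟_{k,loc}∂*Q^{e*}_kf^{(k)}`, `ηL^k = 1`), the cube `□ = X_□*` (unit-lattice bond star of a site set `X_□`),
`□A′ = X_□*·A′`, `□₀` read on `T_η` as the bonds `b` whose k-block endpoints lie in `X₀ ⊆ X_□`; `T = 𝒟_{k,loc}∂*Q^{e*}_k` (data, as in the typed
(5.3.4) `bg534`), `∂ = curl 1` on `T₁^{(k)}`, `Q^{e*} = Qes` (data; `T(Q^{e*}f) = 𝒟_{k,loc}∂*Q^{e*}_{k+1}f` by `Q^{e*}_kQ^{e*} = Q^{e*}_{k+1}`, gen 2's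
`BIJ85Eq224ProofPart2.QestarIter_succ`).  HYPOTHESES at the bond `b ∈ □₀ ∩ Λ̄₁^{(k)*}`: `hT` = the (5.3.4) locality (gen 6), `hdep` = the range
statement *"u_{k,b} doesn't depend on [A′ outside □]"* for `T∂` at `b` (derivable from a range relation by `apply_curl_indicator_eq_of_range`).
CONCLUSION: `u_k(b) = (Q^{s*}_{k+1}v)(b) · exp ie_kη[(Q^{s*}_k(□A′))(b) − (T∂(□A′))(b) − L^{−2}(T(Q^{e*}f))(b)]` (standing range).
[cite: BalabanImbrieJaffe1988, (5.4.2) p.281] -/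
theorem eq542_torus {k : ℕ} (hk : i + k + 1 ≤ P.m + P.K) {ek η : ℝ} (hη : η * (P.L : ℝ) ^ k = 1)
    (X : Finset (Balaban1983to89.Site P (i + k + 1))) {u' : GaugeField P (i + k) U1} {A' : PBond P (i + k) → ℝ}
    (hu : ∀ c ∈ starB (blockUnion 1 X), u' c = expU1 (ek * A' c)) (v : GaugeField P (i + k + 1) U1) (g : PBond P i → ℝ)
    {Plc : Type*} (L : ℝ) (T : (Balaban1983to89.Plaq P (i + k) → ℝ) →ₗ[ℝ] (PBond P i → ℝ))
    (Qes : (Plc → ℝ) →ₗ[ℝ] (Balaban1983to89.Plaq P (i + k) → ℝ)) (f : Plc → ℝ)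
    (Xb X₀ : Finset (Balaban1983to89.Site P (i + k))) (hX₀ : X₀ ⊆ Xb)
    {b : PBond P i} (hb₁ : b ∈ starB (blockUnion (k + 1) X)) (hb₀ : b ∈ starB (blockUnion k X₀))
    (hT : g b = T (curl 1 A' + L⁻¹ ^ 2 • Qes f) b)
    (hdep : ∀ F₁ F₂ : Balaban1983to89.Plaq P (i + k) → ℝ, (∀ p ∈ BIJ88Sect3Statements.starP Xb, F₁ p = F₂ p) → T F₁ b = T F₂ b) :
    backgroundU ek η (fun b => toC (qsstarGIter k (surfMul u' (cutoff (starB X) v)) b)) g b =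
      bgExp ek η (fun b => toC (qsstarGIter (k + 1) v b))
        (fun b => (torusBlockBondsIter P i k).Qsstar ((↑(starB Xb) : Set (PBond P (i + k))).indicator A') b -
          T (curl 1 ((↑(starB Xb) : Set (PBond P (i + k))).indicator A')) b - L⁻¹ ^ 2 * T (Qes f) b) b := by
  -- (5.3.3) inside `Λ̄₁*` at `b` (gen 6's `eq533_inside`), then rewrite the exponent
  rw [eq533_inside hk hη X hu v g hb₁]
  simp only [bgExp]
  congr 1
  -- the exponents agree: `Q^{s*}_kA′ − g = Q^{s*}_k(□A′) − T∂(□A′) − L⁻²T(Qes f)` at `b`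
  have hQ : (torusBlockBondsIter P i k).Qsstar ((↑(starB Xb) : Set (PBond P (i + k))).indicator A') b =
      (torusBlockBondsIter P i k).Qsstar A' b :=
    Qsstar_indicator_of_mem_starB (i := i) (k := k) (by omega) Xb A' (starB_mono (blockUnion_mono k hX₀) hb₀)
  have hcurl : T (curl 1 ((↑(starB Xb) : Set (PBond P (i + k))).indicator A')) b = T (curl 1 A') b :=
    hdep _ _ fun p hp => curl_indicator_of_mem_starP 1 Xb A' hp
  rw [hQ, hcurl, hT, map_add, map_smul, Pi.add_apply, Pi.smul_apply, smul_eq_mul]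
  push_cast
  ring

/-! ## §4 (5.4.3)–(5.4.6) on the torus: the nonlocal gauge transformation (5.4.1) and the background gauge transformation (5.4.5) -/

/-- **(5.4.3)–(5.4.4) ON THE TORUS** (r16's ring identities `eq543`/`eq544` read on functions, for the concrete `Q^{s*}_k`).  p. 282 [PDF 26],
verbatim: *"We now write (Q^{s*}_k − 𝒟_{k,loc}∂*Q^{e*}_k∂)□A′ = (Q^{s*}_k − 𝒟_k∂*Q^{e*}_k∂)□A′ + w′₁A′. (5.4.3) The kernel w′₁ = (𝒟_k −
𝒟_{k,loc})∂*Q^{e*}_k∂□ … The nonlocal gauge transformation (5.4.1) is now applied and we have (Q^{s*}_k − 𝒟_{k,loc}∂*Q^{e*}_k∂)□A′ = (H_k +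
∂C_k)□A′ + w′₁A′ = H_{k,loc}A′ + ∂C_k□A′ + w₁A′. (5.4.4) We have put w₁ = w′₁ + H_k□ − H_{k,loc}"*.  DATA: `T_k = 𝒟_k∂*Q^{e*}_k`, `T_loc =
𝒟_{k,loc}∂*Q^{e*}_k`, `H_k`, `H_{k,loc}`, `C_k` (linear; `∂C_k` = the η-gradient `grad η⁻¹` of the site function `C_kA`, as in (4.16)); HYPOTHESIS
`h541` = (5.4.1) = (2.20) for them (r18's `BIJ88Sect2Statements.Eq220`, on functions): `Q^{s*}_kA − T_k∂A = H_kA + ∂C_kA`.  CONCLUSION, at every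
η-bond: `(Q^{s*}_k − T_loc∂)(□A′) = H_{k,loc}A′ + ∂C_k(□A′) + w₁A′` with `w₁A′ = (T_k − T_loc)∂(□A′) + H_k(□A′) − H_{k,loc}A′` spelled out
(`w′₁A′` = the first summand; standing range not needed). [cite: BalabanImbrieJaffe1988, (5.4.4) p.282] -/
theorem eq544_torus {k : ℕ} {η : ℝ} (Tk Tloc : (Balaban1983to89.Plaq P (i + k) → ℝ) →ₗ[ℝ] (PBond P i → ℝ))
    (Hk Hloc : (PBond P (i + k) → ℝ) →ₗ[ℝ] (PBond P i → ℝ)) (Ck : (PBond P (i + k) → ℝ) →ₗ[ℝ] (Balaban1983to89.Site P i → ℝ))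
    (h541 : ∀ (A : PBond P (i + k) → ℝ) (b : PBond P i),
      (torusBlockBondsIter P i k).Qsstar A b - Tk (curl 1 A) b = Hk A b + grad η⁻¹ (Ck A) b)
    (Bx : Finset (PBond P (i + k))) (A' : PBond P (i + k) → ℝ) (b : PBond P i) :
    (torusBlockBondsIter P i k).Qsstar ((↑Bx : Set (PBond P (i + k))).indicator A') b -
        Tloc (curl 1 ((↑Bx : Set (PBond P (i + k))).indicator A')) b =
      Hloc A' b + grad η⁻¹ (Ck ((↑Bx : Set (PBond P (i + k))).indicator A')) b +
        ((Tk (curl 1 ((↑Bx : Set (PBond P (i + k))).indicator A')) b - Tloc (curl 1 ((↑Bx : Set (PBond P (i + k))).indicator A')) b) +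
          (Hk ((↑Bx : Set (PBond P (i + k))).indicator A') b - Hloc A' b)) := by
  have h := h541 ((↑Bx : Set (PBond P (i + k))).indicator A') b
  linarith

/-- kernel: the gradient is additive over the splitting of a site function by a site cut-off `Λ̄₃`: `∂λ = ∂(Λ̄₃λ) + ∂(Λ̄₃ᶜλ)` (r16's
`grad_add_decomp`) — *"∂C_k□A′ = ∂Λ̄₃^{(k)}C_k□A′ + ∂Λ̄₃^{(k)c}C_k□A′"* between (5.4.4) and (5.4.6). [cite: BalabanImbrieJaffe1988, (5.4.6) p.282] -/
theorem grad_indicator_add_compl {n : ℕ} (c : ℝ) (S : Finset (Balaban1983to89.Site P n)) (lam : Balaban1983to89.Site P n → ℝ)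
    (b : PBond P n) :
    grad c lam b = grad c ((↑S : Set (Balaban1983to89.Site P n)).indicator lam) b +
      grad c ((↑Sᶜ : Set (Balaban1983to89.Site P n)).indicator lam) b := by
  refine BIJ88Sect5StatementsPart3.grad_add_decomp c lam _ _ (fun x => ?_) b
  rw [Finset.coe_compl]
  exact (congrFun (Set.indicator_self_add_compl (↑S : Set (Balaban1983to89.Site P n)) lam) x).symm

/-- **(5.4.5) → (5.4.6) ON THE TORUS.**  p. 282 [PDF 26], verbatim: *"The background gauge transformation u_{k,b} → u′_{k,b} = u_{k,b} exp(−ie_kη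
(∂Λ̄₃^{(k)}C_k□A′)(b)), … (5.4.5) is now performed on the term localized in □₀. The background field becomes u′_k = (Q^{s*}_{k+1}v) exp ie_kη
[H_{k,loc}A′ + ∂Λ̄₃^{(k)c}C_k□A′ + w₁A′ − L^{−2}𝒟_{k,loc}∂*Q^{e*}_{k+1}f], (5.4.6) for b ∈ Λ̄₃^{(k)c*c}; in Λ̄₃^{(k)c*} it is unchanged from the
expression (5.3.3)"*.  HERE, at a bond `b ∈ □₀ ∩ Λ̄₁^{(k)*}` under the hypotheses of `eq542_torus` and `eq544_torus` (`T = T_loc`): the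
(4.16)/(5.4.5) transform `bgGaugeU` (r18) with gauge function `λ = Λ̄₃·C_k(□A′)` (`Λ̄₃` = a site set `S₃` of `T_η`, its cut-off the indicator) of
the background field `u_k` equals `(Q^{s*}_{k+1}v)(b) · exp ie_kη[H_{k,loc}A′ + ∂(Λ̄₃ᶜ·C_k(□A′)) + w₁A′ − L^{−2}T(Q^{e*}f)](b)`, `w₁A′` as in
`eq544_torus` (r16's mechanism `bgGaugeU_bgExp` + `grad_add_decomp`, on the torus; standing range). [cite: BalabanImbrieJaffe1988, (5.4.6) p.282] -/
theorem eq546_torus {k : ℕ} (hk : i + k + 1 ≤ P.m + P.K) {ek η : ℝ} (hη : η * (P.L : ℝ) ^ k = 1)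
    (X : Finset (Balaban1983to89.Site P (i + k + 1))) {u' : GaugeField P (i + k) U1} {A' : PBond P (i + k) → ℝ}
    (hu : ∀ c ∈ starB (blockUnion 1 X), u' c = expU1 (ek * A' c)) (v : GaugeField P (i + k + 1) U1) (g : PBond P i → ℝ)
    {Plc : Type*} (L : ℝ) (Tk Tloc : (Balaban1983to89.Plaq P (i + k) → ℝ) →ₗ[ℝ] (PBond P i → ℝ))
    (Hk Hloc : (PBond P (i + k) → ℝ) →ₗ[ℝ] (PBond P i → ℝ)) (Ck : (PBond P (i + k) → ℝ) →ₗ[ℝ] (Balaban1983to89.Site P i → ℝ))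
    (h541 : ∀ (A : PBond P (i + k) → ℝ) (b : PBond P i),
      (torusBlockBondsIter P i k).Qsstar A b - Tk (curl 1 A) b = Hk A b + grad η⁻¹ (Ck A) b)
    (Qes : (Plc → ℝ) →ₗ[ℝ] (Balaban1983to89.Plaq P (i + k) → ℝ)) (f : Plc → ℝ)
    (Xb X₀ : Finset (Balaban1983to89.Site P (i + k))) (hX₀ : X₀ ⊆ Xb) (S₃ : Finset (Balaban1983to89.Site P i))
    {b : PBond P i} (hb₁ : b ∈ starB (blockUnion (k + 1) X)) (hb₀ : b ∈ starB (blockUnion k X₀))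
    (hT : g b = Tloc (curl 1 A' + L⁻¹ ^ 2 • Qes f) b)
    (hdep : ∀ F₁ F₂ : Balaban1983to89.Plaq P (i + k) → ℝ, (∀ p ∈ BIJ88Sect3Statements.starP Xb, F₁ p = F₂ p) → Tloc F₁ b = Tloc F₂ b) :
    bgGaugeU ek η ((↑S₃ : Set (Balaban1983to89.Site P i)).indicator (Ck ((↑(starB Xb) : Set (PBond P (i + k))).indicator A')))
        (backgroundU ek η (fun b => toC (qsstarGIter k (surfMul u' (cutoff (starB X) v)) b)) g) b =
      bgExp ek η (fun b => toC (qsstarGIter (k + 1) v b))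
        (fun b => Hloc A' b + grad η⁻¹ ((↑S₃ᶜ : Set (Balaban1983to89.Site P i)).indicator
            (Ck ((↑(starB Xb) : Set (PBond P (i + k))).indicator A'))) b +
          ((Tk (curl 1 ((↑(starB Xb) : Set (PBond P (i + k))).indicator A')) b -
              Tloc (curl 1 ((↑(starB Xb) : Set (PBond P (i + k))).indicator A')) b) +
            (Hk ((↑(starB Xb) : Set (PBond P (i + k))).indicator A') b - Hloc A' b)) -
          L⁻¹ ^ 2 * Tloc (Qes f) b) b := by
  -- the transform acts pointwise: unfold it at `b` and insert (5.4.2)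
  have h542 := eq542_torus hk hη X hu v g L Tloc Qes f Xb X₀ hX₀ hb₁ hb₀ hT hdep
  have h544 := eq544_torus Tk Tloc Hk Hloc Ck h541 (starB Xb) A' b
  have hgrad := grad_indicator_add_compl η⁻¹ S₃ (Ck ((↑(starB Xb) : Set (PBond P (i + k))).indicator A')) b
  -- the real identity of the exponents
  have key : ek * η * ((torusBlockBondsIter P i k).Qsstar ((↑(starB Xb) : Set (PBond P (i + k))).indicator A') b -
        Tloc (curl 1 ((↑(starB Xb) : Set (PBond P (i + k))).indicator A')) b - L⁻¹ ^ 2 * Tloc (Qes f) b) +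
      -(ek * η * grad η⁻¹ ((↑S₃ : Set (Balaban1983to89.Site P i)).indicator
          (Ck ((↑(starB Xb) : Set (PBond P (i + k))).indicator A'))) b) =
      ek * η * (Hloc A' b + grad η⁻¹ ((↑S₃ᶜ : Set (Balaban1983to89.Site P i)).indicator
            (Ck ((↑(starB Xb) : Set (PBond P (i + k))).indicator A'))) b +
          ((Tk (curl 1 ((↑(starB Xb) : Set (PBond P (i + k))).indicator A')) b -
              Tloc (curl 1 ((↑(starB Xb) : Set (PBond P (i + k))).indicator A')) b) +
            (Hk ((↑(starB Xb) : Set (PBond P (i + k))).indicator A') b - Hloc A' b)) -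
          L⁻¹ ^ 2 * Tloc (Qes f) b) := by
    linear_combination (ek * η) * h544 + (ek * η) * hgrad
  have keyC := congrArg (fun r : ℝ => (r : ℂ)) key
  simp only [bgGaugeU]
  rw [h542]
  simp only [bgExp]
  rw [mul_assoc, ← Complex.exp_add]
  congr 1
  congr 1
  push_cast at keyC ⊢
  linear_combination I * keyC
end

end Literature.MathematicalPhysics.QuantumFieldTheory.BalabanImbrieJaffe1984to88.BIJ88Eq542Torus
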